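import Literature.Probability.RandomPlanarGeometry.HullRestrictionTests
import Literature.Probability.RandomPlanarGeometry.ConformalMapCaratheodoryProofs
import Literature.Topology.PlaneTopology.EilenbergCriterion
import HarnessLib

/-!
# Separation step — stub `stub_rangeIsArc_separate` of the line `marked-point-revisit`
(crux `SAWLoopFugacityFlow.SimpleSubseqLimits`, stmt-CriticalPhenomena-4982)

Helper H6 (the SEPARATION step (S)) of the sub-stub `stub_rangeIsArc_tests`. Let `(D; a, b)` be a
Dobrushin domain, `φ : ℍ → D` a chordal uniformizing map (`0 ↦ a`, `∞ ↦ b`) with Carathéodory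
extension `φ̄ = φ.boundaryExtension`, `γ ∈ chordalCarrier D` a simple class from `a` to `b` in
`D ∪ {a, b}`, and `c` ANY class from `a` to `b` with trace in `D ∪ {a, b}`. If every ONE-SIGNED
anchored rational test set `T = testSet l` (anchored, all its real points `> 0`, or all `< 0`) whose
image `φ̄ '' T` is avoided by the trace of `γ` is also avoided by the trace of `c`, then the two
traces coincide.

Proof.
* `c.range ⊆ γ.range`: a point `w` of `c.range` off `γ.range` lies in `D` (`a, b ∈ γ.range`); its
  pull-back `z = φ⁻¹ w ∈ ℍ` is off the pulled-back trace `K ∋ 0` of `γ`, a closed subset of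
  `ℍ ∪ {0}` with connected complement (`pullback_trace_spec`, from Jordan arc non-separation
  `JordanArcSeparation_holds` and Carathéodory `exists_continuousOn_extension_holds`). The tree's
  disc-chain construction (`exists_path_to_real`, `exists_dist_le`, `exists_discChain` of
  `HalfPlaneAnchors`) gives a chain of rational closed discs missing `K`, from `z` to a real point;
  we TRUNCATE the chain at its first disc meeting the real axis: the truncated test set is still
  anchored, contains `z`, misses `K`, and all its real points lie in that one disc, a convex set
  missing `0`, hence on one side of `0` (`exists_oneSigned_anchored_testSet`). Its `φ̄`-image
  misses `γ.range` (`MarkedDomain.disjoint_image_boundaryExtension_iff`) but contains `w = φ z`,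
  contradicting the hypothesis.
* `γ.range ⊆ c.range`: `c.range` is a connected subset of the arc `γ.range` containing both of its
  endpoints `a = c.source`, `b = c.target`; pulled back to `[0, 1]` by the injective
  parametrisation (a closed map) it is a preconnected set containing `0` and `1`, i.e. everything
  (`range_subset_of_isPreconnected`).

No vocabulary is introduced: `chordalCarrier`, `IsAnchored`, `testSet`,
`ConformalEquiv.boundaryExtension`, `MarkedDomain.IsChordalUniformizing` are the tree's.
-/

noncomputable section

open MeasureTheory Filter Topology Set Metric Complex
open Literature.Probability.RandomPlanarGeometry
open UpperHalfPlane (upperHalfPlaneSet)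
open scoped unitInterval

namespace Summit.CriticalPhenomena.SAWScalingLimit.Theorems.SimpleSubseqLimits.MarkedPointRevisit.ArcRangeSeparate

/-- **One-signed anchored test sets separate points of `ℍ` from simple paths through `0`.** Let
`K ∋ 0` be a closed subset of `ℍ ∪ {0}` with connected complement and `z ∈ ℍ ∖ K`. Then some
anchored test set `testSet l` whose real points are all `> 0` or all `< 0` contains `z` and misses
`K`. Refines `exists_anchored_testSet` (`HalfPlaneAnchors`): the disc chain from `z` to the real
axis is cut at its first disc with a real point; the earlier discs have no real points and the
real points of that disc form a convex set off `0 ∈ K`. [folklore] -/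
theorem exists_oneSigned_anchored_testSet {K : Set ℂ} (hK : IsClosed K) (hKc : IsConnected Kᶜ)
    (h0K : (0 : ℂ) ∈ K) (hKsub : K ⊆ upperHalfPlaneSet ∪ {0}) {z : ℂ}
    (hz : z ∈ upperHalfPlaneSet) (hzK : z ∉ K) :
    ∃ l : List (ℚ × ℚ × ℚ), IsAnchored (testSet l) ∧
      ((∀ x : ℝ, (x : ℂ) ∈ testSet l → 0 < x) ∨ (∀ x : ℝ, (x : ℂ) ∈ testSet l → x < 0)) ∧
      z ∈ testSet l ∧ Disjoint (testSet l) K := by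
  classical
  have hz0 : 0 < z.im := hz
  obtain ⟨g, hg, τ, hτ, hg0, hgτ, -, hgK⟩ := exists_path_to_real hK hKc hKsub hz hzK
  obtain ⟨δ, hδ, hdist⟩ := Literature.Probability.RandomPlanarGeometry.exists_dist_le hK h0K hg hgK
  obtain ⟨m, c, r, hm0, hin, hnext, hdisj⟩ := exists_discChain hτ hg hδ hdist
  set B : ℕ → Set ℂ := fun j ↦ closedBall (⟨((c j).1 : ℝ), ((c j).2 : ℝ)⟩ : ℂ) r with hB
  have hmR : (0 : ℝ) < m := by exact_mod_cast hm0
  have hgm : g (τ * m / m) = g τ := by rw [mul_div_assoc, div_self hmR.ne', mul_one]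
  have hg0' : g (τ * (0 : ℕ) / m) = z := by simp [hg0]
  -- the first disc with a real point (the last disc contains the real point `g τ`)
  have hex : ∃ j, j ≤ m ∧ ∃ x : ℝ, (x : ℂ) ∈ B j := by
    refine ⟨m, le_rfl, (g τ).re, ?_⟩
    have h1 : ((g τ).re : ℂ) = g τ := Complex.ext (by simp) (by simp [hgτ])
    have h2 := hin m le_rfl
    rwa [hgm, ← h1] at h2
  set n := Nat.find hex with hn
  have hnm : n ≤ m := (Nat.find_spec hex).1
  obtain ⟨x₀, hx₀⟩ : ∃ x : ℝ, (x : ℂ) ∈ B n := (Nat.find_spec hex).2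
  have hmin : ∀ j < n, ∀ x : ℝ, (x : ℂ) ∉ B j := fun j hj x hx ↦
    Nat.find_min hex hj ⟨hj.le.trans hnm, x, hx⟩
  -- the list of the first `n + 1` discs
  set l : List (ℚ × ℚ × ℚ) := (List.range (n + 1)).map fun j ↦ ((c j).1, (c j).2, r) with hl
  have hmemL : ∀ {q : ℚ × ℚ × ℚ}, q ∈ l ↔ ∃ j, j ≤ n ∧ q = ((c j).1, (c j).2, r) := by
    intro q
    simp only [hl, List.mem_map, List.mem_range, Nat.lt_succ_iff]
    exact ⟨fun ⟨j, hj, hq⟩ ↦ ⟨j, hj, hq.symm⟩, fun ⟨j, hj, hq⟩ ↦ ⟨j, hj, hq.symm⟩⟩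
  have hTS : testSet l = (⋃ j ∈ Iic n, B j) ∩ {w : ℂ | 0 ≤ w.im} := by
    ext w
    simp only [testSet, mem_iUnion, mem_inter_iff, mem_Iic, exists_prop, halfDisc, mem_setOf_eq]
    constructor
    · rintro ⟨q, hq, hw, hwim⟩
      obtain ⟨j, hj, rfl⟩ := hmemL.1 hq
      exact ⟨⟨j, hj, hw⟩, hwim⟩
    · rintro ⟨⟨j, hj, hw⟩, hwim⟩
      exact ⟨((c j).1, (c j).2, r), hmemL.2 ⟨j, hj, rfl⟩, hw, hwim⟩
  have h0B : (0 : ℂ) ∉ B n := fun h ↦ Set.disjoint_left.1 (hdisj n hnm) h h0K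
  refine ⟨l, ⟨?_, ?_⟩, ?_, ?_, ?_⟩
  · -- `0 ∉ testSet l` since the discs miss `K ∋ 0`
    rw [hTS]
    rintro ⟨h0, -⟩
    simp only [mem_iUnion, mem_Iic, exists_prop] at h0
    obtain ⟨j, hj, h0j⟩ := h0
    exact Set.disjoint_left.1 (hdisj j (hj.trans hnm)) h0j h0K
  · -- `testSet l ∪ {Im ≤ 0}` is connected: a chain of discs, the last one with a real point
    have hchain : IsPreconnected (⋃ j ∈ Iic n, B j) := by
      refine IsPreconnected.biUnion_of_chain ordConnected_Iic (fun j _ ↦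
        (convex_closedBall _ _).isPreconnected) fun j _ hj1 ↦ ?_
      rw [mem_Iic, Order.succ_eq_add_one] at hj1
      exact ⟨g (τ * j / m), hin j (by omega), hnext j (by omega)⟩
    have hx : (x₀ : ℂ) ∈ (⋃ j ∈ Iic n, B j) ∩ {w : ℂ | w.im ≤ 0} :=
      ⟨mem_iUnion₂.2 ⟨n, mem_Iic.2 le_rfl, hx₀⟩, by simp⟩
    have hU : IsPreconnected ((⋃ j ∈ Iic n, B j) ∪ {w : ℂ | w.im ≤ 0}) :=
      hchain.union' ⟨(x₀ : ℂ), hx⟩ (convex_halfSpace_im_le 0).isPreconnected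
    have heq : testSet l ∪ {w : ℂ | w.im ≤ 0} = (⋃ j ∈ Iic n, B j) ∪ {w : ℂ | w.im ≤ 0} := by
      rw [hTS]
      ext w
      simp only [mem_union, mem_inter_iff, mem_setOf_eq]
      constructor
      · rintro (⟨h1, -⟩ | h2)
        · exact Or.inl h1
        · exact Or.inr h2
      · rintro (h1 | h2)
        · rcases le_or_gt 0 w.im with h | h
          · exact Or.inl ⟨h1, h⟩
          · exact Or.inr h.le
        · exact Or.inr h2
    rw [heq]
    exact ⟨⟨x₀, Or.inr hx.2⟩, hU⟩
  · -- one-signed: every real point of `testSet l` is in the convex disc `B n ∌ 0`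
    have hreal : ∀ x : ℝ, (x : ℂ) ∈ testSet l → (x : ℂ) ∈ B n := by
      intro x hx
      rw [hTS] at hx
      obtain ⟨hx, -⟩ := hx
      simp only [mem_iUnion, mem_Iic, exists_prop] at hx
      obtain ⟨j, hj, hxj⟩ := hx
      rcases hj.lt_or_eq with hlt | rfl
      · exact absurd hxj (hmin j hlt x)
      · exact hxj
    have hsame : ∀ x y : ℝ, (x : ℂ) ∈ B n → (y : ℂ) ∈ B n → x < 0 → 0 < y → False := by
      intro x y hx hy hxneg hypos
      have hxy : 0 < y - x := by linarith
      have ha : (0 : ℝ) ≤ y / (y - x) := div_nonneg hypos.le hxy.le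
      have hb : (0 : ℝ) ≤ -x / (y - x) := div_nonneg (by linarith) hxy.le
      have hab : y / (y - x) + -x / (y - x) = 1 := by
        rw [← add_div, div_eq_one_iff_eq hxy.ne']
        ring
      have hmem := convex_closedBall (⟨((c n).1 : ℝ), ((c n).2 : ℝ)⟩ : ℂ) (r : ℝ) hx hy ha hb hab
      have hcomb : y / (y - x) * x + -x / (y - x) * y = 0 := by
        field_simp
        ring
      have hzero : (y / (y - x)) • (x : ℂ) + (-x / (y - x)) • (y : ℂ) = 0 := by
        rw [Complex.real_smul, Complex.real_smul]
        exact_mod_cast hcomb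
      rw [hzero] at hmem
      exact h0B hmem
    have hx₀0 : x₀ ≠ 0 := by
      rintro rfl
      exact h0B (by exact_mod_cast hx₀)
    rcases lt_or_gt_of_ne hx₀0 with hneg | hpos
    · right
      intro x hx
      have hxB := hreal x hx
      rcases lt_trichotomy x 0 with h | rfl | h
      · exact h
      · exact absurd (by exact_mod_cast hxB) h0B
      · exact (hsame x₀ x hx₀ hxB hneg h).elim
    · left
      intro x hx
      have hxB := hreal x hx
      rcases lt_trichotomy x 0 with h | rfl | h
      · exact (hsame x x₀ hxB hx₀ h hpos).elim
      · exact absurd (by exact_mod_cast hxB) h0B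
      · exact h
  · -- `z = g 0` is in the first disc
    rw [hTS]
    refine ⟨mem_iUnion₂.2 ⟨0, mem_Iic.2 (Nat.zero_le _), ?_⟩, hz0.le⟩
    have := hin 0 (Nat.zero_le _)
    rwa [hg0'] at this
  · rw [hTS]
    refine Set.disjoint_left.2 ?_
    rintro w ⟨hw, -⟩ hwK
    simp only [mem_iUnion, mem_Iic, exists_prop] at hw
    obtain ⟨j, hj, hwj⟩ := hw
    exact Set.disjoint_left.1 (hdisj j (hj.trans hnm)) hwj hwK

/-- **A connected subset of an arc containing both endpoints is the whole arc.** For an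
injective curve `η : [0, 1] → ℂ` and a preconnected `S ⊆ range η` with `η 0, η 1 ∈ S`:
`range η ⊆ S`. Pull `S` back by `η` (a closed injective map, so the preimage is preconnected),
push to `ℝ`, and use that a preconnected subset of `ℝ` containing `0` and `1` contains `[0, 1]`.
[folklore] -/
theorem range_subset_of_isPreconnected {η : Curve ℂ} (hη : η.IsSimple) {S : Set ℂ}
    (hS : IsPreconnected S) (hSr : S ⊆ Set.range η) (h0 : η 0 ∈ S) (h1 : η 1 ∈ S) :
    Set.range η ⊆ S := by
  have hA : IsPreconnected (η ⁻¹' S) :=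
    hS.preimage_of_isClosedMap hη η.continuous.isClosedMap hSr
  have hB : IsPreconnected (Subtype.val '' (η ⁻¹' S) : Set ℝ) :=
    hA.image _ continuous_subtype_val.continuousOn
  have h01 : Icc (0 : ℝ) 1 ⊆ Subtype.val '' (η ⁻¹' S) :=
    hB.Icc_subset ⟨0, h0, rfl⟩ ⟨1, h1, rfl⟩
  rintro _ ⟨t, rfl⟩
  obtain ⟨t', ht', htt'⟩ := h01 t.2
  rw [← Subtype.ext htt']
  exact ht'

/-- **Separation step (S) of `stub_rangeIsArc_tests`.** For a Dobrushin domain `(D; a, b)` with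
chordal uniformizing map `φ`, a chordal simple class `γ ∈ chordalCarrier D` and any class `c`
from `a` to `b` with trace in `D ∪ {a, b}`: if every one-signed anchored rational test set whose
`φ.boundaryExtension`-image is avoided by `γ.range` is also avoided by `c.range`, then
`c.range = γ.range`. (Inclusion `⊆` by `exists_oneSigned_anchored_testSet` applied to the
pulled-back trace of `γ` (`pullback_trace_spec`) and the boundary dictionary
`MarkedDomain.disjoint_image_boundaryExtension_iff`; inclusion `⊇` by
`range_subset_of_isPreconnected`.) [folklore] -/
theorem stub_rangeIsArc_separate :
    ∀ (D : DobrushinDomain) (φ : ConformalEquiv upperHalfPlaneSet D.carrier) (c γ : CurveClass ℂ),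
      D.IsChordalUniformizing φ → c.source = D.pt 0 → c.target = D.pt 1 →
      c.range ⊆ D.carrier ∪ {D.pt 0, D.pt 1} → γ ∈ chordalCarrier D →
      (∀ l : List (ℚ × ℚ × ℚ), IsAnchored (testSet l) →
        ((∀ x : ℝ, (x : ℂ) ∈ testSet l → 0 < x) ∨ (∀ x : ℝ, (x : ℂ) ∈ testSet l → x < 0)) →
        Disjoint γ.range (φ.boundaryExtension '' testSet l) →
        Disjoint c.range (φ.boundaryExtension '' testSet l)) →
      c.range = γ.range := by
  intro D φ c γ hφ hcs hct hcr hγ H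
  have hC : JordanDomain.exists_continuousOn_extension :=
    JordanDomain.exists_continuousOn_extension_holds
  have hJarc : Literature.Topology.PlaneTopology.JordanArcSeparation :=
    Literature.Topology.PlaneTopology.JordanArcSeparation_holds
  obtain ⟨⟨⟨⟨γ₂, hγ₂, rfl⟩, hs₂⟩, ht₂⟩, hr₂⟩ := hγ
  simp only [mem_setOf_eq, CurveClass.source_mk, CurveClass.target_mk, CurveClass.range_mk]
    at hs₂ ht₂ hr₂ H ⊢
  have h0 : γ₂ 0 = D.pt 0 := hs₂
  have h1 : γ₂ 1 = D.pt 1 := ht₂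
  -- (1) `c.range ⊆ γ.range`
  have hsub : c.range ⊆ Set.range γ₂ := by
    intro w hw
    by_contra hw₂
    -- `w ∈ D`: it is off the trace of `γ`, which contains `a` and `b`
    have hwa : w ≠ D.pt 0 := fun h ↦ hw₂ ⟨0, h0.trans h.symm⟩
    have hwb : w ≠ D.pt 1 := fun h ↦ hw₂ ⟨1, h1.trans h.symm⟩
    have hwD : w ∈ D.carrier := by
      rcases hcr hw with h | h
      · exact h
      · rcases h with h | h
        · exact absurd h hwa
        · exact absurd h hwb
    set z := φ.symm w with hz
    have hzH : z ∈ upperHalfPlaneSet := φ.symm_mapsTo hwD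
    -- the pulled-back trace of `γ`
    obtain ⟨K, hKcl, hKc, h0K, hKsub, hKmem, hKrep⟩ :=
      pullback_trace_spec hJarc hC hφ hγ₂ h0 h1 hr₂
    have hzK : z ∉ K := by
      intro hzK'
      have hz0 : z ≠ 0 := by
        rintro h; rw [h] at hzH; exact absurd (show (0:ℝ) < (0:ℂ).im from hzH) (by simp)
      obtain ⟨t, ht0, ht1, hzt⟩ := hKrep z hzK' hz0
      apply hw₂
      refine ⟨t, ?_⟩
      have := congrArg φ hzt
      rw [hz, φ.apply_symm_apply hwD,
        φ.apply_symm_apply (apply_mem_carrier_of_chordal hγ₂ h0 h1 hr₂ ht0 ht1)] at this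
      exact this.symm
    -- a one-signed anchored test set through `z` missing `K`
    obtain ⟨l, hl, hsign, hzl, hlK⟩ := exists_oneSigned_anchored_testSet hKcl hKc h0K hKsub hzH hzK
    have hγdisj : Disjoint (Set.range γ₂) (φ.boundaryExtension '' testSet l) := by
      refine (MarkedDomain.disjoint_image_boundaryExtension_iff hC hφ (testSet_subset_closure l)
        hl.1 hr₂).2 ?_
      rintro v ⟨⟨t, rfl⟩, hvD⟩ hvS
      have ht0 : t ≠ 0 := by rintro rfl; exact D.pt_notMem_carrier 0 (h0 ▸ hvD)
      have ht1 : t ≠ 1 := by rintro rfl; exact D.pt_notMem_carrier 1 (h1 ▸ hvD)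
      exact Set.disjoint_left.1 hlK hvS (hKmem t ht0 ht1)
    have hcdisj := H l hl hsign hγdisj
    refine Set.disjoint_left.1 hcdisj hw ⟨z, hzl, ?_⟩
    rw [φ.boundaryExtension_eq hzH, hz, φ.apply_symm_apply hwD]
  -- (2) `γ.range ⊆ c.range`: a connected subset of an arc containing both endpoints
  refine hsub.antisymm (range_subset_of_isPreconnected hγ₂ ?_ hsub ?_ ?_)
  · obtain ⟨γc, rfl⟩ := CurveClass.surjective_mk c
    exact isPreconnected_range γc.continuous
  · rw [h0, ← hcs]; exact c.source_mem_range
  · rw [h1, ← hct]; exact c.target_mem_range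

end Summit.CriticalPhenomena.SAWScalingLimit.Theorems.SimpleSubseqLimits.MarkedPointRevisit.ArcRangeSeparate

end
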